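import Literature.NumberTheory.LFunctions.LittlewoodOscillationInputs
import Literature.NumberTheory.LFunctions.NicolasJExplicit
import HarnessLib

/-!
# Proof of MV Lemma 15.9 (the averaged explicit formula for `ψ` under RH)

Topic `Literature/NumberTheory/LFunctions`. Discharges the named fact
`Literature.NumberTheory.LFunctions.MontgomeryVaughan2007_lemma15_9` of
`LittlewoodOscillationInputs.lean` (Montgomery–Vaughan, *Multiplicative Number Theory I*, Lemma 15.9):
under RH, uniformly for `x ≥ 4`, `1/(2x) ≤ δ ≤ 1/2`,

  `(1/((e^δ − e^{−δ})x)) ∫_{e^{−δ}x}^{e^{δ}x} (ψ(u) − u) du = −x^{1/2} ∑_ρ m(ρ) (sin γδ/(γδ)) (sin(γ log x)/γ) + O(x^{1/2})`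

(`∑_ρ` over all non-trivial zeros with multiplicity, `= 2∑_{γ>0}`; `littlewoodSum`).

**Proof** (MV p. 479, run on the tree's absolutely convergent explicit formula for
`ψ₁(t) = ∫₀ᵗ ψ`, `Literature.NumberTheory.LFunctions.psiOne_eq_explicit` in the form
`ψ₁(t) − t²/2 = −Z(t) − (log 2π)t + E(t)`, `Z(t) = ∑_ρ m(ρ) t^{ρ+1}/(ρ(ρ+1))`, `|E(t)| ≤ C_E √t`
(`NicolasJExplicit.Rone_eq_explicit`, `exists_norm_psiOneRemainder_le`)). With `a = e^{−δ}x`,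
`b = e^{δ}x`, `h = e^δ − e^{−δ}`: `∫_a^b (ψ(u) − u) du = (ψ₁(b) − b²/2) − (ψ₁(a) − a²/2)`
(`NicolasJ.integral_psi`), so the left side is the real part of
`−∑_ρ D_ρ − log 2π + (E(b) − E(a))/(hx)` with
`D_ρ = m(ρ) x^ρ (e^{δ(ρ+1)} − e^{−δ(ρ+1)})/(h ρ(ρ+1))`. For each zero (RH: `ρ = 1/2 + iγ`) one has
`|Re D_ρ − x^{1/2} m(ρ)(sin γδ/(γδ))(sin(γ log x)/γ)| ≤ (6 + 3/(4g₀)) m(ρ) x^{1/2}/γ²` (`perZero`;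
`g₀` a lower bound for `|γ|`): replace `e^{±δ(ρ+1)} = e^{±3δ/2}e^{±iγδ}` by `e^{±iγδ}` (error
`≤ 6δ`, against `h ≥ 2δ`), `1/h` by `1/(2δ)` (error `≤ 1/2`, against `|e^{iγδ} − e^{−iγδ}| ≤ 2`), and
`1/(ρ(ρ+1))` by `−1/γ²` (error `≤ (3/4 + 2|γ|)/γ⁴`, against `|sin γδ|/δ ≤ |γ|`); what is left is
`−i x^{1/2} x^{iγ} sin(γδ)/(δγ²)`, of real part `x^{1/2}(sin γδ/(γδ))(sin(γ log x)/γ)`. (MV bound the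
middle step through `∑_{γ ≤ 1/δ} 1/γ + δ^{−1}∑_{γ>1/δ} γ^{−2} ≪ log²(1/δ)`; the cruder bookkeeping here
needs only `∑_ρ m(ρ)/γ² < ∞`.) Summing, `∑ m(ρ)/γ² < ∞` gives `O(x^{1/2})`; finally `log 2π ≤ 2 ≤ x^{1/2}`
and `|E(b) − E(a)|/(hx) ≤ 3C_E√x/(2δx) ≤ 3C_E √x` as `1/(2δ) ≤ x`.

Main result: `Literature.NumberTheory.LFunctions.MontgomeryVaughan2007_lemma15_9_holds`.

## References

* [MontgomeryVaughan2007] H. L. Montgomery, R. C. Vaughan, *Multiplicative Number Theory I. Classical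
  Theory*, CUP 2007, §15.2, Lemma 15.9 (held copy, PDF pp. 363–364) and (13.7).
-/

noncomputable section

open Complex Filter Set MeasureTheory Topology
open scoped Real Chebyshev

namespace Literature.NumberTheory.LFunctions

namespace LittlewoodAverage

open NicolasJExplicit NicolasJ

/-! ### Elementary estimates -/

/-- `γ² ≤ |ρ(ρ+1)|` for `ρ = 1/2 + iγ`. [folklore] -/
theorem sq_le_norm_rho_mul (γ : ℝ) :
    γ ^ 2 ≤ ‖((1 / 2 : ℂ) + γ * I) * ((1 / 2 : ℂ) + γ * I + 1)‖ := by
  rw [norm_mul]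
  have h1 : |γ| ≤ ‖(1 / 2 : ℂ) + γ * I‖ := by
    have := Complex.abs_im_le_norm ((1 / 2 : ℂ) + γ * I)
    simpa using this
  have h2 : |γ| ≤ ‖(1 / 2 : ℂ) + γ * I + 1‖ := by
    have := Complex.abs_im_le_norm ((1 / 2 : ℂ) + γ * I + 1)
    simpa using this
  calc γ ^ 2 = |γ| * |γ| := by rw [← sq, sq_abs]
    _ ≤ _ := mul_le_mul h1 h2 (abs_nonneg _) (norm_nonneg _)

/-- `2δ ≤ e^δ − e^{−δ}` for `δ ≥ 0` (`δ ≤ sinh δ`). [folklore] -/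
theorem two_mul_le_exp_sub_exp {δ : ℝ} (hδ : 0 ≤ δ) : 2 * δ ≤ Real.exp δ - Real.exp (-δ) := by
  have h := (Real.self_le_sinh_iff).2 hδ
  rw [Real.sinh_eq] at h
  linarith

/-- `|e^δ − e^{−δ} − 2δ| ≤ 2δ²` for `|δ| ≤ 1`. [folklore] -/
theorem abs_exp_sub_exp_sub_le {δ : ℝ} (hδ : |δ| ≤ 1) :
    |Real.exp δ - Real.exp (-δ) - 2 * δ| ≤ 2 * δ ^ 2 := by
  have h1 := Real.abs_exp_sub_one_sub_id_le hδ
  have h2 := Real.abs_exp_sub_one_sub_id_le (x := -δ) (by simpa using hδ)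
  have e : Real.exp δ - Real.exp (-δ) - 2 * δ =
      (Real.exp δ - 1 - δ) - (Real.exp (-δ) - 1 - -δ) := by ring
  rw [e]
  refine (abs_sub _ _).trans ?_
  have : (-δ) ^ 2 = δ ^ 2 := by ring
  linarith

/-- `|e^{δ(ρ+1)} − e^{−δ(ρ+1)} − (e^{iγδ} − e^{−iγδ})| ≤ 6δ` for `ρ = 1/2 + iγ`, `0 ≤ δ ≤ 1/2`
("`e^{±δ(ρ+1)} = e^{±iγδ} + O(δ)`", MV p. 478). [cite: MontgomeryVaughan2007, Lemma 15.9 (proof)] -/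
theorem norm_exp_sub_exp_sub_le {δ : ℝ} (hδ : 0 ≤ δ) (hδ2 : δ ≤ 1 / 2) (γ : ℝ) :
    ‖(cexp (δ * ((1 / 2 : ℂ) + γ * I + 1)) - cexp (-(δ * ((1 / 2 : ℂ) + γ * I + 1)))) -
        (cexp ((γ * δ : ℝ) * I) - cexp (-((γ * δ : ℝ) * I)))‖ ≤ 6 * δ := by
  have e1 : cexp (δ * ((1 / 2 : ℂ) + γ * I + 1)) =
      (Real.exp (3 / 2 * δ) : ℂ) * cexp ((γ * δ : ℝ) * I) := by
    rw [Complex.ofReal_exp, ← Complex.exp_add]; congr 1; push_cast; ring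
  have e2 : cexp (-(δ * ((1 / 2 : ℂ) + γ * I + 1))) =
      (Real.exp (-(3 / 2 * δ)) : ℂ) * cexp (-((γ * δ : ℝ) * I)) := by
    rw [Complex.ofReal_exp, ← Complex.exp_add]; congr 1; push_cast; ring
  rw [e1, e2]
  have hu1 : ‖cexp ((γ * δ : ℝ) * I)‖ = 1 := Complex.norm_exp_ofReal_mul_I _
  have hu2 : ‖cexp (-((γ * δ : ℝ) * I))‖ = 1 := by
    rw [show -((γ * δ : ℝ) * I) = ((-(γ * δ) : ℝ) : ℂ) * I by push_cast; ring]
    exact Complex.norm_exp_ofReal_mul_I _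
  have h3 : |3 / 2 * δ| ≤ 1 := by rw [abs_of_nonneg (by positivity)]; linarith
  have hr1 : |Real.exp (3 / 2 * δ) - 1| ≤ 3 * δ := by
    have := Real.abs_exp_sub_one_le h3
    rw [abs_of_nonneg (by positivity : (0:ℝ) ≤ 3 / 2 * δ)] at this
    linarith
  have hr2 : |Real.exp (-(3 / 2 * δ)) - 1| ≤ 3 * δ := by
    have := Real.abs_exp_sub_one_le (x := -(3 / 2 * δ)) (by rwa [abs_neg])
    rw [abs_neg, abs_of_nonneg (by positivity : (0:ℝ) ≤ 3 / 2 * δ)] at this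
    linarith
  have e3 : (Real.exp (3 / 2 * δ) : ℂ) * cexp ((γ * δ : ℝ) * I) -
      (Real.exp (-(3 / 2 * δ)) : ℂ) * cexp (-((γ * δ : ℝ) * I)) -
      (cexp ((γ * δ : ℝ) * I) - cexp (-((γ * δ : ℝ) * I))) =
      ((Real.exp (3 / 2 * δ) - 1 : ℝ) : ℂ) * cexp ((γ * δ : ℝ) * I) -
        ((Real.exp (-(3 / 2 * δ)) - 1 : ℝ) : ℂ) * cexp (-((γ * δ : ℝ) * I)) := by
    push_cast; ring
  rw [e3]
  refine (norm_sub_le _ _).trans ?_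
  rw [norm_mul, norm_mul, hu1, hu2, mul_one, mul_one, Complex.norm_real, Complex.norm_real,
    Real.norm_eq_abs, Real.norm_eq_abs]
  linarith

/-- `e^{iθ} − e^{−iθ} = 2i sin θ`. [folklore] -/
theorem exp_sub_exp_eq_sin (t : ℝ) :
    cexp ((t : ℂ) * I) - cexp (-((t : ℂ) * I)) = 2 * Real.sin t * I := by
  rw [show -((t : ℂ) * I) = ((-t : ℝ) : ℂ) * I by push_cast; ring, Complex.exp_mul_I,
    Complex.exp_mul_I]
  push_cast
  rw [Complex.cos_neg, Complex.sin_neg, ← Complex.ofReal_sin, ← Complex.ofReal_cos]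
  push_cast
  ring

/-! ### The estimate for one zero -/

/-- **One zero of MV Lemma 15.9.** For `ρ = 1/2 + iγ` with `|γ| ≥ g₀ > 0`, `0 < δ ≤ 1/2`, `X ≥ 0` and
real `L` (think `X = x^{1/2}`, `L = log x`, so that `x^ρ = X e^{iγL}`):
`|Re(X e^{iγL}(e^{δ(ρ+1)} − e^{−δ(ρ+1)})/((e^δ − e^{−δ})ρ(ρ+1))) − X (sin γδ/(γδ))(sin γL/γ)| ≤ (6 + 3/(4g₀)) X/γ²`.
[cite: MontgomeryVaughan2007, Lemma 15.9 (proof)] -/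
theorem perZero {γ δ L X g₀ : ℝ} (hg0 : 0 < g₀) (hg : g₀ ≤ |γ|) (hδ : 0 < δ) (hδ2 : δ ≤ 1 / 2)
    (hX : 0 ≤ X) :
    |(X * cexp ((γ * L : ℝ) * I) *
        (cexp (δ * ((1 / 2 : ℂ) + γ * I + 1)) - cexp (-(δ * ((1 / 2 : ℂ) + γ * I + 1)))) /
        (((Real.exp δ - Real.exp (-δ) : ℝ) : ℂ) * (((1 / 2 : ℂ) + γ * I) * ((1 / 2 : ℂ) + γ * I + 1)))).re -
      X * (Real.sin (γ * δ) / (γ * δ) * (Real.sin (γ * L) / γ))| ≤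
      (6 + 3 / (4 * g₀)) * X / γ ^ 2 := by
  set ρ : ℂ := (1 / 2 : ℂ) + γ * I with hρ
  set P : ℂ := ρ * (ρ + 1) with hP
  set h : ℝ := Real.exp δ - Real.exp (-δ) with hh
  set E₁ : ℂ := cexp (δ * (ρ + 1)) - cexp (-(δ * (ρ + 1))) with hE₁
  set S : ℂ := cexp (((γ * δ : ℝ) : ℂ) * I) - cexp (-(((γ * δ : ℝ) : ℂ) * I)) with hS
  set uL : ℂ := cexp (((γ * L : ℝ) : ℂ) * I) with huL
  have hγ0 : γ ≠ 0 := fun h0 ↦ by rw [h0, abs_zero] at hg; linarith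
  have hγpos : 0 < |γ| := abs_pos.2 hγ0
  have hγ2 : 0 < γ ^ 2 := by positivity
  have hPge : γ ^ 2 ≤ ‖P‖ := sq_le_norm_rho_mul γ
  have hP0 : P ≠ 0 := fun h0 ↦ by rw [h0, norm_zero] at hPge; linarith
  have hPpos : 0 < ‖P‖ := norm_pos_iff.2 hP0
  have hh2 : 2 * δ ≤ h := two_mul_le_exp_sub_exp hδ.le
  have hhpos : 0 < h := by linarith
  have hhabs : |h - 2 * δ| ≤ 2 * δ ^ 2 :=
    abs_exp_sub_exp_sub_le (by rw [abs_of_pos hδ]; linarith)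
  have hE₁S : ‖E₁ - S‖ ≤ 6 * δ := norm_exp_sub_exp_sub_le hδ.le hδ2 γ
  have hSeq : S = 2 * Real.sin (γ * δ) * I := exp_sub_exp_eq_sin _
  have hSnorm : ‖S‖ = 2 * |Real.sin (γ * δ)| := by
    rw [hSeq, norm_mul, norm_mul, Complex.norm_I, mul_one, Complex.norm_real, Real.norm_eq_abs,
      Complex.norm_two]
  have hS2 : ‖S‖ ≤ 2 := by rw [hSnorm]; linarith [Real.abs_sin_le_one (γ * δ)]
  have hSle : ‖S‖ ≤ 2 * (|γ| * δ) := by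
    rw [hSnorm]; have := Real.abs_sin_le_abs (x := γ * δ); rw [abs_mul, abs_of_pos hδ] at this
    linarith
  have huLn : ‖uL‖ = 1 := Complex.norm_exp_ofReal_mul_I _
  have hPγ : P + (γ : ℂ) ^ 2 = (3 / 4 : ℂ) + 2 * γ * I := by
    rw [hP, hρ]; ring_nf; rw [Complex.I_sq]; ring
  have hPγn : ‖P + (γ : ℂ) ^ 2‖ ≤ 3 / 4 + 2 * |γ| := by
    rw [hPγ]
    refine (norm_add_le _ _).trans ?_
    rw [norm_mul, norm_mul, Complex.norm_I, mul_one, Complex.norm_real, Real.norm_eq_abs,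
      Complex.norm_two]
    norm_num
  set M : ℂ := X * uL * S * (-1 / (γ : ℂ) ^ 2) / (2 * δ) with hM
  set D : ℂ := X * uL * E₁ / ((h : ℂ) * P) with hD
  have hγc : (γ : ℂ) ≠ 0 := by exact_mod_cast hγ0
  have hhc : (h : ℂ) ≠ 0 := by exact_mod_cast hhpos.ne'
  have hδc : (δ : ℂ) ≠ 0 := by exact_mod_cast hδ.ne'
  have hdecomp : D - M = X * uL * ((E₁ - S) / ((h : ℂ) * P) + S * (1 / (h : ℂ) - 1 / (2 * δ)) / P +
      S / (2 * δ) * ((P + (γ : ℂ) ^ 2) / (P * (γ : ℂ) ^ 2))) := by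
    rw [hD, hM]
    field_simp
    ring
  have ht1 : ‖(E₁ - S) / ((h : ℂ) * P)‖ ≤ 3 / γ ^ 2 := by
    rw [norm_div, norm_mul, Complex.norm_real, Real.norm_eq_abs, abs_of_pos hhpos]
    rw [div_le_div_iff₀ (by positivity) hγ2]
    calc ‖E₁ - S‖ * γ ^ 2 ≤ 6 * δ * γ ^ 2 := by gcongr
      _ = 3 * (2 * δ * γ ^ 2) := by ring
      _ ≤ 3 * (h * ‖P‖) := by gcongr
  have ht2 : ‖S * (1 / (h : ℂ) - 1 / (2 * δ)) / P‖ ≤ 1 / γ ^ 2 := by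
    have hinv : ‖(1 / (h : ℂ) - 1 / (2 * δ))‖ ≤ 1 / 2 := by
      have e : (1 / (h : ℂ) - 1 / (2 * δ)) = (((2 * δ - h) / (h * (2 * δ)) : ℝ) : ℂ) := by
        push_cast; field_simp
      rw [e, Complex.norm_real, Real.norm_eq_abs, abs_div, abs_of_pos (by positivity : 0 < h * (2 * δ)),
        div_le_div_iff₀ (by positivity) (by norm_num : (0:ℝ) < 2), abs_sub_comm]
      calc |h - 2 * δ| * 2 ≤ 2 * δ ^ 2 * 2 := by gcongr
        _ = δ * (2 * δ) * 2 := by ring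
        _ ≤ 1 * (h * (2 * δ)) := by nlinarith
    rw [norm_div, norm_mul, div_le_div_iff₀ hPpos hγ2]
    calc ‖S‖ * ‖1 / (h : ℂ) - 1 / (2 * δ)‖ * γ ^ 2 ≤ 2 * (1 / 2) * γ ^ 2 := by gcongr
      _ = γ ^ 2 := by ring
      _ ≤ 1 * ‖P‖ := by linarith
  have ht3 : ‖S / (2 * δ) * ((P + (γ : ℂ) ^ 2) / (P * (γ : ℂ) ^ 2))‖ ≤ (2 + 3 / (4 * g₀)) / γ ^ 2 := by
    have h2δ : ‖(2 * δ : ℂ)‖ = 2 * δ := by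
      rw [show (2 * δ : ℂ) = ((2 * δ : ℝ) : ℂ) by push_cast; ring, Complex.norm_real,
        Real.norm_eq_abs, abs_of_pos (by positivity)]
    have hPγ2 : ‖P * (γ : ℂ) ^ 2‖ = ‖P‖ * γ ^ 2 := by
      rw [norm_mul, norm_pow, Complex.norm_real, Real.norm_eq_abs, sq_abs]
    rw [norm_mul, norm_div, norm_div, h2δ, hPγ2]
    have hA : ‖S‖ / (2 * δ) ≤ |γ| := by
      rw [div_le_iff₀ (by positivity)]; linarith
    have hB : ‖P + (γ : ℂ) ^ 2‖ / (‖P‖ * γ ^ 2) ≤ (3 / 4 + 2 * |γ|) / (γ ^ 2 * γ ^ 2) := by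
      gcongr
    calc ‖S‖ / (2 * δ) * (‖P + (γ : ℂ) ^ 2‖ / (‖P‖ * γ ^ 2))
        ≤ |γ| * ((3 / 4 + 2 * |γ|) / (γ ^ 2 * γ ^ 2)) := by gcongr
      _ = (3 / 4 * |γ| + 2 * γ ^ 2) / γ ^ 2 / γ ^ 2 := by
          field_simp
          rw [← sq_abs γ]; ring
      _ ≤ (2 + 3 / (4 * g₀)) / γ ^ 2 := by
          rw [div_le_div_iff_of_pos_right hγ2, div_le_iff₀ hγ2]
          have : 3 / 4 * |γ| ≤ 3 / (4 * g₀) * γ ^ 2 := by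
            rw [← sq_abs γ]
            have h1 : g₀ * |γ| ≤ |γ| * |γ| := mul_le_mul_of_nonneg_right hg (abs_nonneg γ)
            have h2 : 3 / (4 * g₀) * (g₀ * |γ|) ≤ 3 / (4 * g₀) * (|γ| * |γ|) :=
              mul_le_mul_of_nonneg_left h1 (by positivity)
            have h3 : 3 / (4 * g₀) * (g₀ * |γ|) = 3 / 4 * |γ| := by field_simp
            rw [sq]; linarith
          nlinarith
  have hDM : ‖D - M‖ ≤ (6 + 3 / (4 * g₀)) * X / γ ^ 2 := by
    rw [hdecomp, norm_mul, norm_mul, huLn, mul_one, Complex.norm_real, Real.norm_eq_abs,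
      abs_of_nonneg hX]
    have hsum : ‖(E₁ - S) / ((h : ℂ) * P) + S * (1 / (h : ℂ) - 1 / (2 * δ)) / P +
        S / (2 * δ) * ((P + (γ : ℂ) ^ 2) / (P * (γ : ℂ) ^ 2))‖ ≤ (6 + 3 / (4 * g₀)) / γ ^ 2 := by
      refine (norm_add₃_le).trans ?_
      have : 3 / γ ^ 2 + 1 / γ ^ 2 + (2 + 3 / (4 * g₀)) / γ ^ 2 = (6 + 3 / (4 * g₀)) / γ ^ 2 := by ring
      linarith
    calc X * ‖_‖ ≤ X * ((6 + 3 / (4 * g₀)) / γ ^ 2) := by gcongr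
      _ = (6 + 3 / (4 * g₀)) * X / γ ^ 2 := by ring
  have hMre : M.re = X * (Real.sin (γ * δ) / (γ * δ) * (Real.sin (γ * L) / γ)) := by
    have e : M = (((X * Real.sin (γ * L) * Real.sin (γ * δ) / (δ * γ ^ 2)) : ℝ) : ℂ) +
        (((-(X * Real.cos (γ * L) * Real.sin (γ * δ) / (δ * γ ^ 2))) : ℝ) : ℂ) * I := by
      rw [hM, hSeq, huL, Complex.exp_mul_I, ← Complex.ofReal_sin, ← Complex.ofReal_cos]
      push_cast
      field_simp
      ring_nf
      rw [Complex.I_sq]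
      ring
    rw [e, Complex.add_re, Complex.ofReal_re, Complex.re_ofReal_mul, Complex.I_re, mul_zero, add_zero]
    field_simp
  have hfinal : |D.re - X * (Real.sin (γ * δ) / (γ * δ) * (Real.sin (γ * L) / γ))| ≤ ‖D - M‖ := by
    rw [← hMre, ← Complex.sub_re]
    exact Complex.abs_re_le_norm _
  exact hfinal.trans hDM

/-! ### Summability of `∑ m(ρ)/γ²` -/

/-- **`∑_ρ m(ρ)/γ² < ∞`** over the non-trivial zeros (from the tree's `∑ m(ρ)/(1+γ²) < ∞` and the gap
`|γ| ≥ 2δ₀`). [cite: MontgomeryVaughan2007, Thm. 10.13] -/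
theorem summable_zeroOrder_div_im_sq :
    Summable fun ρ : Zeros ↦ (riemannZetaZeroOrder (ρ : ℂ) : ℝ) / (ρ : ℂ).im ^ 2 := by
  obtain ⟨δ₀, hδ₀, -, hgap⟩ := ZetaZeroSum.exists_gap_im
  have hS := ZetaZeroSum.summable_zeroOrder_div_one_add_sq
  refine Summable.of_nonneg_of_le (fun ρ ↦ div_nonneg (zeroOrder_nonneg' ρ) (sq_nonneg _))
    (fun ρ ↦ ?_) (hS.mul_left (1 + (2 * δ₀)⁻¹ ^ 2))
  have hm := zeroOrder_nonneg' ρ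
  have hγ : 2 * δ₀ ≤ |(ρ : ℂ).im| := hgap _ ρ.2
  have hγ0 : 0 < |(ρ : ℂ).im| := lt_of_lt_of_le (by positivity) hγ
  have hsq : (2 * δ₀) ^ 2 ≤ (ρ : ℂ).im ^ 2 := by
    rw [← sq_abs (ρ : ℂ).im]; exact pow_le_pow_left₀ (by positivity) hγ 2
  have hγ2 : 0 < (ρ : ℂ).im ^ 2 := by rw [← sq_abs]; positivity
  rw [div_le_iff₀ hγ2]
  calc (riemannZetaZeroOrder (ρ : ℂ) : ℝ)
      = (riemannZetaZeroOrder (ρ : ℂ) : ℝ) * 1 := (mul_one _).symm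
    _ ≤ (riemannZetaZeroOrder (ρ : ℂ) : ℝ) *
          ((1 + (2 * δ₀)⁻¹ ^ 2) * (ρ : ℂ).im ^ 2 / (1 + (ρ : ℂ).im ^ 2)) := by
        refine mul_le_mul_of_nonneg_left ?_ hm
        rw [le_div_iff₀ (by positivity)]
        have : 1 ≤ (2 * δ₀)⁻¹ ^ 2 * (ρ : ℂ).im ^ 2 := by
          rw [inv_pow, inv_mul_eq_div, le_div_iff₀ (by positivity), one_mul]
          exact hsq
        nlinarith
    _ = (1 + (2 * δ₀)⁻¹ ^ 2) * ((riemannZetaZeroOrder (ρ : ℂ) : ℝ) / (1 + (ρ : ℂ).im ^ 2)) *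
          (ρ : ℂ).im ^ 2 := by
        field_simp

/-! ### The difference of two zero terms -/

/-- `t^w = e^{(log t) w}` for real `t > 0`. [folklore] -/
theorem ofReal_cpow_eq_exp {t : ℝ} (ht : 0 < t) (w : ℂ) : ((t : ℂ)) ^ w = cexp (Real.log t * w) := by
  rw [Complex.cpow_def_of_ne_zero (by exact_mod_cast ht.ne'), Complex.ofReal_log ht.le]

/-- Under RH a non-trivial zero is `1/2 + iγ`. [folklore] -/
theorem coe_eq_of_RH (hRH : RiemannHypothesis) (ρ : Zeros) :
    (ρ : ℂ) = (1 / 2 : ℂ) + ((ρ : ℂ).im : ℂ) * I := by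
  apply Complex.ext
  · simp [re_eq_half_of_RH hRH ρ.2]
  · simp

/-- **The differenced zero term.** Under RH, for `x > 0` and real `δ`, with `h = e^δ − e^{−δ}`,
`X = e^{(log x)/2} = x^{1/2}`, `γ = Im ρ`:
`(m(ρ)b^{ρ+1}/(ρ(ρ+1)) − m(ρ)a^{ρ+1}/(ρ(ρ+1)))/(hx) = m(ρ) · X e^{iγ log x}(e^{δ(ρ+1)} − e^{−δ(ρ+1)})/(h ρ(ρ+1))`
(`a = e^{−δ}x`, `b = e^{δ}x`). [cite: MontgomeryVaughan2007, Lemma 15.9 (proof), (15.21)] -/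
theorem zeroTerm_sub_zeroTerm_div (hRH : RiemannHypothesis) (ρ : Zeros) {x : ℝ} (hx : 0 < x) {δ : ℝ}
    (hδ : 0 < δ) :
    (zeroTerm ρ (Real.exp δ * x) - zeroTerm ρ (Real.exp (-δ) * x)) /
        ((((Real.exp δ - Real.exp (-δ)) * x : ℝ)) : ℂ) =
      (riemannZetaZeroOrder (ρ : ℂ) : ℂ) *
        (Real.exp (Real.log x / 2) * cexp ((((ρ : ℂ).im * Real.log x : ℝ) : ℂ) * I) *
          (cexp (δ * ((1 / 2 : ℂ) + ((ρ : ℂ).im : ℂ) * I + 1)) -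
            cexp (-(δ * ((1 / 2 : ℂ) + ((ρ : ℂ).im : ℂ) * I + 1)))) /
          (((Real.exp δ - Real.exp (-δ) : ℝ) : ℂ) *
            (((1 / 2 : ℂ) + ((ρ : ℂ).im : ℂ) * I) * ((1 / 2 : ℂ) + ((ρ : ℂ).im : ℂ) * I + 1)))) := by
  set γ : ℝ := (ρ : ℂ).im with hγ
  set ρ' : ℂ := (1 / 2 : ℂ) + (γ : ℂ) * I with hρ'
  have hρρ : (ρ : ℂ) = ρ' := coe_eq_of_RH hRH ρ
  set ℓx : ℝ := Real.log x with hℓx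
  have hb : 0 < Real.exp δ * x := by positivity
  have ha : 0 < Real.exp (-δ) * x := by positivity
  have hlogb : Real.log (Real.exp δ * x) = δ + ℓx := by
    rw [Real.log_mul (Real.exp_pos δ).ne' hx.ne', Real.log_exp]
  have hloga : Real.log (Real.exp (-δ) * x) = -δ + ℓx := by
    rw [Real.log_mul (Real.exp_pos _).ne' hx.ne', Real.log_exp]
  -- the two powers
  have hbw : (((Real.exp δ * x : ℝ)) : ℂ) ^ (ρ' + 1) =
      cexp (δ * (ρ' + 1)) * (cexp (ℓx / 2) * cexp ((γ * ℓx : ℝ) * I)) * cexp ℓx := by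
    rw [ofReal_cpow_eq_exp hb, hlogb, ← Complex.exp_add, ← Complex.exp_add, ← Complex.exp_add]
    congr 1
    rw [hρ']; push_cast; ring
  have haw : (((Real.exp (-δ) * x : ℝ)) : ℂ) ^ (ρ' + 1) =
      cexp (-(δ * (ρ' + 1))) * (cexp (ℓx / 2) * cexp ((γ * ℓx : ℝ) * I)) * cexp ℓx := by
    rw [ofReal_cpow_eq_exp ha, hloga, ← Complex.exp_add, ← Complex.exp_add, ← Complex.exp_add]
    congr 1
    rw [hρ']; push_cast; ring
  have hxexp : ((x : ℝ) : ℂ) = cexp ℓx := by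
    rw [hℓx, ← Complex.ofReal_exp, Real.exp_log hx]
  -- nonvanishing
  have hP0 : ρ' * (ρ' + 1) ≠ 0 := by
    intro h0
    have := sq_le_norm_rho_mul γ
    rw [← hρ', h0, norm_zero] at this
    have hγ0 : γ ≠ 0 := ZetaZeros.riemannZetaNontrivialZeros.im_ne_zero ρ.2
    exact hγ0 (by nlinarith [sq_nonneg γ])
  have hexpℓ : cexp ℓx ≠ 0 := Complex.exp_ne_zero _
  have hE : cexp (δ : ℂ) - cexp (-(δ : ℂ)) ≠ 0 := by
    rw [← Complex.ofReal_neg, ← Complex.ofReal_exp, ← Complex.ofReal_exp, ← Complex.ofReal_sub]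
    exact_mod_cast (lt_of_lt_of_le (by positivity) (two_mul_le_exp_sub_exp hδ.le)).ne'
  unfold zeroTerm
  rw [hρρ, hbw, haw]
  push_cast
  rw [hxexp]
  field_simp

/-! ### The main estimate -/

/-- `log 2π ≤ 2`. [folklore] -/
theorem log_two_pi_le_two : Real.log (2 * π) ≤ 2 := by
  rw [Real.log_le_iff_le_exp (by positivity)]
  have h1 : (2.7182818283 : ℝ) < Real.exp 1 := Real.exp_one_gt_d9
  have h2 : Real.exp 2 = Real.exp 1 * Real.exp 1 := by rw [← Real.exp_add]; norm_num
  have h3 := Real.pi_lt_d2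
  nlinarith [Real.exp_pos 1]

set_option maxHeartbeats 400000 in
/-- **MV Lemma 15.9 holds** (the averaged explicit formula for `ψ` under RH, with an explicit
`O`-constant): discharge of `Literature.NumberTheory.LFunctions.MontgomeryVaughan2007_lemma15_9`.
[cite: MontgomeryVaughan2007, Lemma 15.9] -/
theorem lemma15_9 (hRH : RiemannHypothesis) :
    ∃ C : ℝ, ∀ x : ℝ, 4 ≤ x → ∀ δ : ℝ, 1 / (2 * x) ≤ δ → δ ≤ 1 / 2 →
      |1 / ((Real.exp δ - Real.exp (-δ)) * x) *
            (∫ u in (Real.exp (-δ) * x)..(Real.exp δ * x), (ψ u - u)) +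
          x ^ (1 / 2 : ℝ) * littlewoodSum δ x| ≤ C * x ^ (1 / 2 : ℝ) := by
  obtain ⟨δ₀, hδ₀, -, hgap⟩ := ZetaZeroSum.exists_gap_im
  obtain ⟨CE, hCE0, hCE⟩ := exists_norm_psiOneRemainder_le
  set g₀ : ℝ := 2 * δ₀ with hg₀
  have hg₀pos : 0 < g₀ := by positivity
  set C₀ : ℝ := 6 + 3 / (4 * g₀) with hC₀
  have hC₀pos : 0 < C₀ := by positivity
  set S₂ : ℝ := ∑' ρ : Zeros, (riemannZetaZeroOrder (ρ : ℂ) : ℝ) / (ρ : ℂ).im ^ 2 with hS₂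
  have hS₂0 : 0 ≤ S₂ := tsum_nonneg fun ρ ↦ div_nonneg (zeroOrder_nonneg' ρ) (sq_nonneg _)
  refine ⟨C₀ * S₂ + 1 + 3 * CE, fun x hx δ hδx hδ2 ↦ ?_⟩
  -- basic quantities
  have hx0 : 0 < x := by linarith
  have hδ : 0 < δ := lt_of_lt_of_le (by positivity) hδx
  set h : ℝ := Real.exp δ - Real.exp (-δ) with hh
  have hh2 : 2 * δ ≤ h := two_mul_le_exp_sub_exp hδ.le
  have hhpos : 0 < h := by linarith
  set a : ℝ := Real.exp (-δ) * x with ha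
  set b : ℝ := Real.exp δ * x with hb
  have hea : 1 / 2 ≤ Real.exp (-δ) := by
    have := Real.add_one_le_exp (-δ); linarith
  have heb : Real.exp δ ≤ 3 := by
    have h1 : Real.exp δ ≤ Real.exp 1 := Real.exp_le_exp.2 (by linarith)
    have h2 := Real.exp_one_lt_d9; linarith
  have ha1 : 1 ≤ a := by rw [ha]; nlinarith
  have hb1 : 1 ≤ b := by
    rw [hb]; have : 1 ≤ Real.exp δ := Real.one_le_exp hδ.le
    nlinarith
  have hab : b - a = h * x := by rw [ha, hb, hh]; ring
  set X : ℝ := x ^ (1 / 2 : ℝ) with hX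
  have hXexp : Real.exp (Real.log x / 2) = X := by
    rw [hX, Real.rpow_def_of_pos hx0]; ring_nf
  have hXsqrt : Real.sqrt x = X := by rw [hX, Real.sqrt_eq_rpow]
  have hX0 : 0 < X := Real.rpow_pos_of_pos hx0 _
  have hX2 : 2 ≤ X := by
    rw [← hXsqrt]
    rw [show (2 : ℝ) = Real.sqrt 4 by rw [show (4:ℝ) = 2 ^ 2 by norm_num, Real.sqrt_sq (by norm_num)]]
    exact Real.sqrt_le_sqrt hx
  -- Step 1: the integral is `R₁(b) − R₁(a)`
  have hint : ∫ u in a..b, (ψ u - u) = Rone b - Rone a := by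
    have hI : IntervalIntegrable (fun u : ℝ ↦ u) volume a b := continuous_id.intervalIntegrable a b
    rw [intervalIntegral.integral_sub (intervalIntegrable_psi a b) hI, integral_psi, integral_id]
    simp only [Rone]
    ring
  -- Step 2: the explicit formula, differenced and divided by `hx`
  set Dρ : Zeros → ℂ := fun ρ ↦ (zeroTerm ρ b - zeroTerm ρ a) / ((h * x : ℝ) : ℂ) with hDρ
  have hsumD : Summable Dρ := ((summable_zeroTerm hb1).sub (summable_zeroTerm ha1)).div_const _
  have hhx0 : ((h * x : ℝ) : ℂ) ≠ 0 := by exact_mod_cast (mul_pos hhpos hx0).ne'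
  have hident : (((Rone b - Rone a) / (h * x) : ℝ) : ℂ) =
      -∑' ρ : Zeros, Dρ ρ - Complex.log (2 * π) +
        (psiOneRemainder b - psiOneRemainder a) / ((h * x : ℝ) : ℂ) := by
    have eb := Rone_eq_explicit hb1
    have ea := Rone_eq_explicit ha1
    have hZ : Zsum b - Zsum a = ∑' ρ : Zeros, (zeroTerm ρ b - zeroTerm ρ a) := by
      rw [Zsum, Zsum, ← (summable_zeroTerm hb1).tsum_sub (summable_zeroTerm ha1)]
    have hD : ∑' ρ : Zeros, Dρ ρ = (Zsum b - Zsum a) / ((h * x : ℝ) : ℂ) := by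
      rw [hZ, hDρ, tsum_div_const]
    rw [hD]
    push_cast
    rw [eb, ea]
    have hb' : ((b : ℝ) : ℂ) = (a : ℂ) + (h : ℂ) * (x : ℂ) := by
      rw [← Complex.ofReal_mul, ← hab]; push_cast; ring
    have hhc : (h : ℂ) ≠ 0 := by exact_mod_cast hhpos.ne'
    have hxc : (x : ℂ) ≠ 0 := by exact_mod_cast hx0.ne'
    field_simp
    rw [hb']
    ring
  -- Step 3: the real part, zero by zero
  have hre : (Rone b - Rone a) / (h * x) =
      -∑' ρ : Zeros, (Dρ ρ).re - Real.log (2 * π) +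
        ((psiOneRemainder b - psiOneRemainder a) / ((h * x : ℝ) : ℂ)).re := by
    have := congrArg Complex.re hident
    rw [Complex.ofReal_re] at this
    have hlog : (Complex.log (2 * π)).re = Real.log (2 * π) := by
      rw [show (2 * π : ℂ) = ((2 * π : ℝ) : ℂ) by push_cast; ring, Complex.log_ofReal_re]
    rw [this]
    simp only [Complex.add_re, Complex.sub_re, Complex.neg_re]
    rw [Complex.re_tsum hsumD, hlog]
  have hper : ∀ ρ : Zeros, |(Dρ ρ).re - X * littlewoodTerm δ x ρ| ≤
      C₀ * X * ((riemannZetaZeroOrder (ρ : ℂ) : ℝ) / (ρ : ℂ).im ^ 2) := by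
    intro ρ
    have hm := zeroOrder_nonneg' ρ
    have hγ : g₀ ≤ |(ρ : ℂ).im| := hgap _ ρ.2
    have key := perZero (L := Real.log x) (X := X) hg₀pos hγ hδ hδ2 hX0.le
    have hD' : Dρ ρ = (riemannZetaZeroOrder (ρ : ℂ) : ℂ) *
        (X * cexp ((((ρ : ℂ).im * Real.log x : ℝ) : ℂ) * I) *
          (cexp (δ * ((1 / 2 : ℂ) + ((ρ : ℂ).im : ℂ) * I + 1)) -
            cexp (-(δ * ((1 / 2 : ℂ) + ((ρ : ℂ).im : ℂ) * I + 1)))) /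
          (((Real.exp δ - Real.exp (-δ) : ℝ) : ℂ) *
            (((1 / 2 : ℂ) + ((ρ : ℂ).im : ℂ) * I) * ((1 / 2 : ℂ) + ((ρ : ℂ).im : ℂ) * I + 1)))) := by
      rw [hDρ]
      simp only [ha, hb, hh]
      rw [zeroTerm_sub_zeroTerm_div hRH ρ hx0 hδ, hXexp]
    set Q : ℂ := X * cexp ((((ρ : ℂ).im * Real.log x : ℝ) : ℂ) * I) *
          (cexp (δ * ((1 / 2 : ℂ) + ((ρ : ℂ).im : ℂ) * I + 1)) -
            cexp (-(δ * ((1 / 2 : ℂ) + ((ρ : ℂ).im : ℂ) * I + 1)))) /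
          (((Real.exp δ - Real.exp (-δ) : ℝ) : ℂ) *
            (((1 / 2 : ℂ) + ((ρ : ℂ).im : ℂ) * I) * ((1 / 2 : ℂ) + ((ρ : ℂ).im : ℂ) * I + 1))) with hQ
    have hDre : (Dρ ρ).re = (riemannZetaZeroOrder (ρ : ℂ) : ℝ) * Q.re := by
      rw [hD', ← Complex.ofReal_intCast, Complex.re_ofReal_mul]
    have hfac : (Dρ ρ).re - X * littlewoodTerm δ x ρ = (riemannZetaZeroOrder (ρ : ℂ) : ℝ) *
        (Q.re - X * (Real.sin ((ρ : ℂ).im * δ) / ((ρ : ℂ).im * δ) *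
          (Real.sin ((ρ : ℂ).im * Real.log x) / (ρ : ℂ).im))) := by
      rw [hDre, littlewoodTerm]; ring
    rw [hfac, abs_mul, abs_of_nonneg hm]
    calc (riemannZetaZeroOrder (ρ : ℂ) : ℝ) * |Q.re - X * (Real.sin ((ρ : ℂ).im * δ) / ((ρ : ℂ).im * δ) *
          (Real.sin ((ρ : ℂ).im * Real.log x) / (ρ : ℂ).im))|
        ≤ (riemannZetaZeroOrder (ρ : ℂ) : ℝ) * (C₀ * X / (ρ : ℂ).im ^ 2) :=
          mul_le_mul_of_nonneg_left key hm
      _ = C₀ * X * ((riemannZetaZeroOrder (ρ : ℂ) : ℝ) / (ρ : ℂ).im ^ 2) := by ring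
  -- Step 4: summing over the zeros
  have hsumRe : Summable fun ρ : Zeros ↦ (Dρ ρ).re := (Complex.hasSum_re hsumD.hasSum).summable
  have hsumL : Summable fun ρ : Zeros ↦ littlewoodTerm δ x ρ := summable_littlewoodTerm δ x
  have hmaj : Summable fun ρ : Zeros ↦
      C₀ * X * ((riemannZetaZeroOrder (ρ : ℂ) : ℝ) / (ρ : ℂ).im ^ 2) :=
    summable_zeroOrder_div_im_sq.mul_left _
  have hdiff : ∑' ρ : Zeros, (Dρ ρ).re - X * littlewoodSum δ x =
      ∑' ρ : Zeros, ((Dρ ρ).re - X * littlewoodTerm δ x ρ) := by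
    rw [littlewoodSum, ← tsum_mul_left, ← hsumRe.tsum_sub (hsumL.mul_left X)]
  have habs : |∑' ρ : Zeros, ((Dρ ρ).re - X * littlewoodTerm δ x ρ)| ≤ C₀ * X * S₂ := by
    have h1 : Summable fun ρ : Zeros ↦ |(Dρ ρ).re - X * littlewoodTerm δ x ρ| :=
      Summable.of_nonneg_of_le (fun _ ↦ abs_nonneg _) hper hmaj
    calc |∑' ρ : Zeros, ((Dρ ρ).re - X * littlewoodTerm δ x ρ)|
        ≤ ∑' ρ : Zeros, |(Dρ ρ).re - X * littlewoodTerm δ x ρ| := by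
          have := norm_tsum_le_tsum_norm (f := fun ρ : Zeros ↦ (Dρ ρ).re - X * littlewoodTerm δ x ρ)
            (by simpa only [Real.norm_eq_abs] using h1)
          simpa only [Real.norm_eq_abs] using this
      _ ≤ ∑' ρ : Zeros, C₀ * X * ((riemannZetaZeroOrder (ρ : ℂ) : ℝ) / (ρ : ℂ).im ^ 2) :=
          h1.tsum_le_tsum hper hmaj
      _ = C₀ * X * S₂ := by rw [tsum_mul_left]
  -- Step 5: the remainder `(E(b) − E(a))/(hx)`
  have hhx1 : 1 ≤ h * x := by
    have h2x : (0 : ℝ) < 2 * x := by positivity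
    rw [div_le_iff₀ h2x] at hδx
    nlinarith
  have hrem : |((psiOneRemainder b - psiOneRemainder a) / ((h * x : ℝ) : ℂ)).re| ≤ 3 * CE * X := by
    refine (Complex.abs_re_le_norm _).trans ?_
    rw [norm_div, Complex.norm_real, Real.norm_eq_abs, abs_of_pos (mul_pos hhpos hx0),
      div_le_iff₀ (mul_pos hhpos hx0)]
    have hEb := hCE b (by linarith)
    have hEa := hCE a (by linarith)
    have hsb : Real.sqrt b ≤ 2 * X := by
      have h4 : b ≤ 4 * x := by rw [hb]; nlinarith
      calc Real.sqrt b ≤ Real.sqrt (4 * x) := Real.sqrt_le_sqrt h4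
        _ = 2 * X := by
          rw [Real.sqrt_mul (by norm_num), hXsqrt,
            show (4 : ℝ) = 2 ^ 2 by norm_num, Real.sqrt_sq (by norm_num)]
    have hsa : Real.sqrt a ≤ X := by
      rw [← hXsqrt]
      refine Real.sqrt_le_sqrt ?_
      have : Real.exp (-δ) ≤ 1 := by rw [Real.exp_le_one_iff]; linarith
      rw [ha]; nlinarith
    have hnum : ‖psiOneRemainder b - psiOneRemainder a‖ ≤ 3 * CE * X := by
      refine (norm_sub_le _ _).trans ?_
      have h1 : CE * Real.sqrt b ≤ CE * (2 * X) := mul_le_mul_of_nonneg_left hsb hCE0.le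
      have h2 : CE * Real.sqrt a ≤ CE * X := mul_le_mul_of_nonneg_left hsa hCE0.le
      linarith
    have h3 : 0 ≤ 3 * CE * X := by positivity
    nlinarith
  -- Step 6: conclusion
  have hlog := log_two_pi_le_two
  have hlog0 : 0 ≤ Real.log (2 * π) := Real.log_nonneg (by linarith [Real.pi_gt_three])
  rw [hint]
  have hfin : 1 / (h * x) * (Rone b - Rone a) + X * littlewoodSum δ x =
      -(∑' ρ : Zeros, ((Dρ ρ).re - X * littlewoodTerm δ x ρ)) - Real.log (2 * π) +
        ((psiOneRemainder b - psiOneRemainder a) / ((h * x : ℝ) : ℂ)).re := by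
    rw [one_div_mul_eq_div, hre, ← hdiff]; ring
  rw [hfin]
  have htri : ∀ A l R : ℝ, 0 ≤ l → |-A - l + R| ≤ |A| + l + |R| := by
    intro A l R hl
    calc |-A - l + R| ≤ |-A - l| + |R| := abs_add_le _ _
      _ ≤ |-A| + |l| + |R| := by gcongr; exact abs_sub _ _
      _ = |A| + l + |R| := by rw [abs_neg, abs_of_nonneg hl]
  refine (htri _ _ _ hlog0).trans ?_
  calc |∑' ρ : Zeros, ((Dρ ρ).re - X * littlewoodTerm δ x ρ)| + Real.log (2 * π) +
        |((psiOneRemainder b - psiOneRemainder a) / ((h * x : ℝ) : ℂ)).re|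
      ≤ C₀ * X * S₂ + X + 3 * CE * X := by linarith
    _ = (C₀ * S₂ + 1 + 3 * CE) * X := by ring

end LittlewoodAverage

/-- **MV Lemma 15.9 holds**: discharge of the named fact
`Literature.NumberTheory.LFunctions.MontgomeryVaughan2007_lemma15_9` (the averaged explicit formula for `ψ`
under RH, `LittlewoodOscillationInputs.lean`). [cite: MontgomeryVaughan2007, Lemma 15.9] -/
theorem MontgomeryVaughan2007_lemma15_9_holds : MontgomeryVaughan2007_lemma15_9 :=
  fun hRH ↦ LittlewoodAverage.lemma15_9 hRH


end Literature.NumberTheory.LFunctions
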